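import Literature.IUT.HodgeTheaters.TemperedCoveringsProp2122SubAt
import Literature.IUT.HodgeTheaters.TemperedCoveringsByNameAt
import Literature.IUT.HodgeTheaters.TemperedCoveringsByNameAtCountable
import Literature.AnabelianGeometry.SemiGraphs.TemperedCompactInVerticialFinite
import Literature.AnabelianGeometry.SemiGraphs.TemperedVerticialNamedFactsProofs
import Literature.AnabelianGeometry.SemiGraphs.TemperedGaloisDomination
import HarnessLib

/-!
# [IUTchI] Prop. 2.1 / 2.2 for FINITE dual semi-graphs: EVERY [SemiAnbd] §3 named input DISCHARGED

Mochizuki, *Inter-universal Teichmüller theory I*, kurims manuscript (May 2020), §2, Proposition 2.1 /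
Proposition 2.2 / Remark 2.2.2, pp. 45–46 [cite: Mochizuki2012, Prop 2.1 p.45] (D-0012 claim key; series
status DISPUTED; nothing of the series is asserted here).

PROOF-ONLY closing file of the φ2-consumers L5 block (abc-iut cell; seat abc-iut-L3-d1, item L5e): the
per-graph twins `…_at` of `TemperedCoveringsChartsAt.lean` / `…ByNameAt.lean` / `…NodNonAt.lean` /
`…Prop2122SubAt.lean` / `…ChartsAtCountable.lean` / `…ByNameAtCountable.lean` take
`(hCV : CompactInVerticialAt 𝒢)` ([SemiAnbd] Thm 3.7 (iii) at the ONE graph); seat abc-iut-L3-t8's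
`ProfiniteSemiGraph.compactInVerticialAt_of_finiteGraph` (`TemperedCompactInVerticialFinite.lean`:
Thm 3.7 (iii) PROVED for every FINITE `𝔾`, print p. 41 "since the semi-graphs `𝔾_j` are all finite")
discharges that hypothesis whenever the underlying semi-graph of `𝒢` is finite — which the dual
semi-graph of a pointed stable curve is.  The two other [SemiAnbd] §3 inputs the originals bind BY NAME
are kernel theorems as well and are discharged here too: `VerticialInjective` (Thm 3.7 (i)) is
abc-iut-L3-t8's `verticialInjective_holds`, and "Galois domination with residually finite deck groups"
(the `hGal` binder, [SemiAnbd] Prop 3.6 (iii) proof) is abc-iut-L3-t7's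
`ProfiniteSemiGraph.galoisDomination_of_prop36` under `Thm37Hypotheses ⊇ Prop36Hypotheses`.  Hence the
[IUTchI] §2 kernels below carry NO [SemiAnbd] §3 named hypothesis at all: the remaining inputs are the
structural identifications of the data (`e : Π^tp_𝔾 ≃ₜ* π₁^temp(𝒢)` a chart, `IsProfiniteCompletion`
of `Π^tp_𝔾 → Π̂_𝔾`, the verticial family, node data with (A3) resp. [NodNon] Lem 1.9 (ii)
`VerticialIntersectionNear`, `hHatH`).  Decl suffix `_of_finiteGraph`; one-line compositions; originals
untouched.  Typed ≠ proved for the [IUTchI] nodes themselves; nothing here bears on [IUTchIII] Cor. 3.12.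
-/

namespace Literature.IUT.HodgeTheaters

open Pointwise Filter
open _root_.Topology
open Literature.AnabelianGeometry.SemiGraphs (IsTempered IsProfiniteCompletion PSCDatum ProfiniteSemiGraph)
open Literature.AnabelianGeometry.SemiGraphs.ProfiniteSemiGraph (TemperedPiChart verticialSubgroups
  VerticialInjective compactInVerticialAt_of_finiteGraph verticialInjective_holds galoisDomination_of_prop36)
open Literature.AnabelianGeometry.AbsoluteAnabelian (IsCommensurablyTerminal)

universe u

namespace TemperedGraphGroupData

variable (D : TemperedGraphGroupData.{u}) {𝒢 𝒢H : ProfiniteSemiGraph.{u}}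

/-! ### (A1) and the forms with node data + (A3) (no `PSCDatum`, no Galois domination / (RF)) -/

/-- **(A1) for a FINITE `𝔾`, no Thm 3.7 hypothesis**: every compact `Λ ⊆ Π^tp_𝔾` lies in a conjugate of
the chosen verticial subgroup at some vertex ([IUTchI] p. 45 "it follows from [SemiAnbd] Thm 3.7 (iii)
…"), Thm 3.7 (iii) supplied by `compactInVerticialAt_of_finiteGraph`. [cite: Mochizuki2012, Prop 2.1 p.45] -/
theorem conj_le_of_finiteGraph [Finite 𝒢.graph.Vertex] [Finite 𝒢.graph.Edge] (c : TemperedPiChart 𝒢)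
    (e : D.Tp ≃ₜ* c.G) (h𝒢 : 𝒢.Thm37Hypotheses) (Λv : 𝒢.graph.Vertex → Subgroup D.Tp)
    (hΛv : ∀ v, (Λv v).map (e : D.Tp →* c.G) ∈ verticialSubgroups c v)
    (Λ : Subgroup D.Tp) (hΛc : IsCompact (Λ : Set D.Tp)) :
    ∃ (v : 𝒢.graph.Vertex) (t : D.Tp), Λ ≤ MulAut.conj t • Λv v :=
  D.conj_le_of_compactInVerticial_at c e h𝒢 compactInVerticialAt_of_finiteGraph Λv hΛv Λ hΛc

/-- **[IUTchI] Prop. 2.1 AS TYPED for a FINITE dual semi-graph, NO [SemiAnbd] §3 hypothesis**: inputs a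
chart `c` of `π₁^temp(𝒢)` identified with `Π^tp_𝔾` along `e`, the Thm 3.7 hypotheses of `𝒢`, `Π̂_𝔾` the
profinite completion of `Π^tp_𝔾`, a verticial family, node data + (A3); Thm 3.7 (iii) is
`compactInVerticialAt_of_finiteGraph`, (A0) is the chart's Galois-countability (no (RF), no Galois
domination). ([IUTchI] Prop 2.1 p.45) [claim: Mochizuki2012, status: disputed] -/
theorem prop21_of_isProfiniteCompletion_of_finiteGraph [Finite 𝒢.graph.Vertex] [Finite 𝒢.graph.Edge]
    (c : TemperedPiChart 𝒢) (e : D.Tp ≃ₜ* c.G) (h𝒢 : 𝒢.Thm37Hypotheses)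
    (hPC : IsProfiniteCompletion
      ({ toMonoidHom := D.ι, continuous_toFun := D.ι_continuous } : D.Tp →ₜ* D.Hat))
    (Λv : 𝒢.graph.Vertex → Subgroup D.Tp)
    (hΛv : ∀ v, (Λv v).map (e : D.Tp →* c.G) ∈ verticialSubgroups c v)
    {E : Type*} (src tgt : E → 𝒢.graph.Vertex) (c₁ c₂ : E → D.Tp)
    (hA3 : ∀ (v w : 𝒢.graph.Vertex) (g h : D.Hat),
      MulAut.conj g • (Λv v).map D.ι ⊓ MulAut.conj h • (Λv w).map D.ι ≠ ⊥ →
        (v = w ∧ g⁻¹ * h ∈ (Λv v).map D.ι) ∨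
        ∃ (e : E) (k : D.Hat), ∃ p ∈ (Λv (src e)).map D.ι, ∃ q ∈ (Λv (tgt e)).map D.ι,
          (src e = v ∧ tgt e = w ∧ g = k * D.ι (c₁ e) * p ∧ h = k * D.ι (c₂ e) * q) ∨
          (src e = w ∧ tgt e = v ∧ h = k * D.ι (c₁ e) * p ∧ g = k * D.ι (c₂ e) * q)) :
    D.ProfiniteConjugatesOfCompactSubgroups :=
  D.prop21_of_chart_of_isProfiniteCompletion_at' c e h𝒢 compactInVerticialAt_of_finiteGraph hPC Λv hΛv
    src tgt c₁ c₂ hA3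

/-- **[IUTchI] Prop. 2.2, "in particular, `Π^tp_𝔾` is commensurably terminal in `Π̂_𝔾`", for a FINITE dual
semi-graph, NO [SemiAnbd] §3 hypothesis** (Thm 3.7 (i) = `verticialInjective_holds`, Thm 3.7 (iii) =
`compactInVerticialAt_of_finiteGraph`); inputs as in `prop21_of_isProfiniteCompletion_of_finiteGraph`.
([IUTchI] Prop 2.2 p.45) [claim: Mochizuki2012, status: disputed] -/
theorem tp_isCommensurablyTerminal_of_isProfiniteCompletion_of_finiteGraph [Finite 𝒢.graph.Vertex]
    [Finite 𝒢.graph.Edge] (c : TemperedPiChart 𝒢) (e : D.Tp ≃ₜ* c.G) (h𝒢 : 𝒢.Thm37Hypotheses)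
    (hPC : IsProfiniteCompletion
      ({ toMonoidHom := D.ι, continuous_toFun := D.ι_continuous } : D.Tp →ₜ* D.Hat))
    (Λv : 𝒢.graph.Vertex → Subgroup D.Tp)
    (hΛv : ∀ v, (Λv v).map (e : D.Tp →* c.G) ∈ verticialSubgroups c v)
    {E : Type*} (src tgt : E → 𝒢.graph.Vertex) (c₁ c₂ : E → D.Tp)
    (hA3 : ∀ (v w : 𝒢.graph.Vertex) (g h : D.Hat),
      MulAut.conj g • (Λv v).map D.ι ⊓ MulAut.conj h • (Λv w).map D.ι ≠ ⊥ →
        (v = w ∧ g⁻¹ * h ∈ (Λv v).map D.ι) ∨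
        ∃ (e : E) (k : D.Hat), ∃ p ∈ (Λv (src e)).map D.ι, ∃ q ∈ (Λv (tgt e)).map D.ι,
          (src e = v ∧ tgt e = w ∧ g = k * D.ι (c₁ e) * p ∧ h = k * D.ι (c₂ e) * q) ∨
          (src e = w ∧ tgt e = v ∧ h = k * D.ι (c₁ e) * p ∧ g = k * D.ι (c₂ e) * q)) :
    IsCommensurablyTerminal D.ι.range :=
  D.tp_isCommensurablyTerminal_of_chart_of_isProfiniteCompletion_at' c e h𝒢
    compactInVerticialAt_of_finiteGraph verticialInjective_holds hPC Λv hΛv src tgt c₁ c₂ hA3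

/-- **[IUTchI] Rmk 2.2.2: `Π^tp_𝔾` NORMALLY terminal in `Π̂_𝔾`**, for a FINITE dual semi-graph, NO
[SemiAnbd] §3 hypothesis — the `TemperedNormallyTerminal` packaging of
`tp_isCommensurablyTerminal_of_isProfiniteCompletion_of_finiteGraph`. ([IUTchI] Rmk 2.2.2 p.46)
[claim: Mochizuki2012, status: disputed] -/
theorem temperedNormallyTerminal_of_isProfiniteCompletion_of_finiteGraph [Finite 𝒢.graph.Vertex]
    [Finite 𝒢.graph.Edge] (c : TemperedPiChart 𝒢) (e : D.Tp ≃ₜ* c.G) (h𝒢 : 𝒢.Thm37Hypotheses)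
    (hPC : IsProfiniteCompletion
      ({ toMonoidHom := D.ι, continuous_toFun := D.ι_continuous } : D.Tp →ₜ* D.Hat))
    (Λv : 𝒢.graph.Vertex → Subgroup D.Tp)
    (hΛv : ∀ v, (Λv v).map (e : D.Tp →* c.G) ∈ verticialSubgroups c v)
    {E : Type*} (src tgt : E → 𝒢.graph.Vertex) (c₁ c₂ : E → D.Tp)
    (hA3 : ∀ (v w : 𝒢.graph.Vertex) (g h : D.Hat),
      MulAut.conj g • (Λv v).map D.ι ⊓ MulAut.conj h • (Λv w).map D.ι ≠ ⊥ →
        (v = w ∧ g⁻¹ * h ∈ (Λv v).map D.ι) ∨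
        ∃ (e : E) (k : D.Hat), ∃ p ∈ (Λv (src e)).map D.ι, ∃ q ∈ (Λv (tgt e)).map D.ι,
          (src e = v ∧ tgt e = w ∧ g = k * D.ι (c₁ e) * p ∧ h = k * D.ι (c₂ e) * q) ∨
          (src e = w ∧ tgt e = v ∧ h = k * D.ι (c₁ e) * p ∧ g = k * D.ι (c₂ e) * q)) :
    D.TemperedNormallyTerminal :=
  D.temperedNormallyTerminal_of_chart_of_isProfiniteCompletion_at' c e h𝒢
    compactInVerticialAt_of_finiteGraph verticialInjective_holds hPC Λv hΛv src tgt c₁ c₂ hA3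

/-! ### The forms BY NAME over a `PSCDatum` ([NodNon] Lem 1.9 (ii) as the input for (A3)) -/

/-- **[IUTchI] Prop. 2.1 AS TYPED for a FINITE dual semi-graph, every printed input BY NAME and NO
[SemiAnbd] §3 hypothesis**: Thm 3.7 (iii) is `compactInVerticialAt_of_finiteGraph` and Galois domination
is `galoisDomination_of_prop36 h𝒢.toProp36Hypotheses`; the other inputs as in `prop21_byName`.
([IUTchI] Prop 2.1 p.45) [claim: Mochizuki2012, status: disputed] -/
theorem prop21_byName_of_finiteGraph [Finite 𝒢.graph.Vertex] [Finite 𝒢.graph.Edge]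
    (c : TemperedPiChart 𝒢) (e : D.Tp ≃ₜ* c.G) (h𝒢 : 𝒢.Thm37Hypotheses)
    (hPC : IsProfiniteCompletion
      ({ toMonoidHom := D.ι, continuous_toFun := D.ι_continuous } : D.Tp →ₜ* D.Hat))
    (G : PSCDatum D.Hat) (hNN : G.VerticialIntersectionNear) (σ : 𝒢.graph.Vertex ≃ G.graph.V)
    (Λv : G.graph.V → Subgroup D.Tp)
    (hvert : ∀ v : 𝒢.graph.Vertex, (Λv (σ v)).map (e : D.Tp →* c.G) ∈ verticialSubgroups c v)
    (hΛv : ∀ v, (Λv v).map D.ι = G.vertGp v)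
    (src tgt : G.graph.N → G.graph.V) (c₁ c₂ : G.graph.N → D.Tp)
    (hends : ∀ e, G.graph.nodeEnds e = s(src e, tgt e))
    (h₁ : ∀ e, G.nodeGp e ≤ MulAut.conj (D.ι (c₁ e)) • G.vertGp (src e))
    (h₂ : ∀ e, G.nodeGp e ≤ MulAut.conj (D.ι (c₂ e)) • G.vertGp (tgt e))
    (hloop : ∀ e, src e = tgt e → (c₁ e)⁻¹ * c₂ e ∉ Λv (src e)) :
    D.ProfiniteConjugatesOfCompactSubgroups :=
  D.prop21_byName_at c e h𝒢 compactInVerticialAt_of_finiteGraph hPC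
    (galoisDomination_of_prop36 h𝒢.toProp36Hypotheses) G hNN σ Λv hvert hΛv src tgt c₁ c₂ hends h₁ h₂
    hloop

/-- **[IUTchI] Prop. 2.2, "in particular, `Π^tp_𝔾` is commensurably terminal in `Π̂_𝔾`", for a FINITE dual
semi-graph, every printed input BY NAME and NO [SemiAnbd] §3 hypothesis** (Thm 3.7 (i) =
`verticialInjective_holds`, Thm 3.7 (iii) = `compactInVerticialAt_of_finiteGraph`, Galois domination =
`galoisDomination_of_prop36`). ([IUTchI] Prop 2.2 p.45) [claim: Mochizuki2012, status: disputed] -/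
theorem prop22_inParticular_byName_of_finiteGraph [Finite 𝒢.graph.Vertex] [Finite 𝒢.graph.Edge]
    (c : TemperedPiChart 𝒢) (e : D.Tp ≃ₜ* c.G) (h𝒢 : 𝒢.Thm37Hypotheses)
    (hPC : IsProfiniteCompletion
      ({ toMonoidHom := D.ι, continuous_toFun := D.ι_continuous } : D.Tp →ₜ* D.Hat))
    (G : PSCDatum D.Hat) (hNN : G.VerticialIntersectionNear) (σ : 𝒢.graph.Vertex ≃ G.graph.V)
    (Λv : G.graph.V → Subgroup D.Tp)
    (hvert : ∀ v : 𝒢.graph.Vertex, (Λv (σ v)).map (e : D.Tp →* c.G) ∈ verticialSubgroups c v)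
    (hΛv : ∀ v, (Λv v).map D.ι = G.vertGp v)
    (src tgt : G.graph.N → G.graph.V) (c₁ c₂ : G.graph.N → D.Tp)
    (hends : ∀ e, G.graph.nodeEnds e = s(src e, tgt e))
    (h₁ : ∀ e, G.nodeGp e ≤ MulAut.conj (D.ι (c₁ e)) • G.vertGp (src e))
    (h₂ : ∀ e, G.nodeGp e ≤ MulAut.conj (D.ι (c₂ e)) • G.vertGp (tgt e))
    (hloop : ∀ e, src e = tgt e → (c₁ e)⁻¹ * c₂ e ∉ Λv (src e)) :
    IsCommensurablyTerminal D.ι.range :=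
  D.prop22_inParticular_byName_at c e h𝒢 compactInVerticialAt_of_finiteGraph verticialInjective_holds hPC
    (galoisDomination_of_prop36 h𝒢.toProp36Hypotheses) G hNN σ Λv hvert hΛv src tgt c₁ c₂ hends h₁ h₂
    hloop

/-- **[IUTchI] Prop. 2.2 AS TYPED (the four commensurator clauses) for FINITE dual semi-graphs of the
`𝔾`- and `ℍ`-data, every printed input BY NAME and NO [SemiAnbd] §3 hypothesis at either graph**
(Thm 3.7 (i)/(iii) and Galois domination discharged at `𝒢` and at `𝒢H`).
([IUTchI] Prop 2.2 pp.45–46) [claim: Mochizuki2012, status: disputed] -/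
theorem prop22_byName_of_finiteGraph [T2Space D.Tp] [Finite 𝒢.graph.Vertex] [Finite 𝒢.graph.Edge]
    [Finite 𝒢H.graph.Vertex] [Finite 𝒢H.graph.Edge] (hcH : IsClosed (D.HatH : Set D.Hat))
    (c : TemperedPiChart 𝒢) (e : D.Tp ≃ₜ* c.G) (h𝒢 : 𝒢.Thm37Hypotheses)
    (hPC : IsProfiniteCompletion
      ({ toMonoidHom := D.ι, continuous_toFun := D.ι_continuous } : D.Tp →ₜ* D.Hat))
    (G : PSCDatum D.Hat) (hNN : G.VerticialIntersectionNear) (σ : 𝒢.graph.Vertex ≃ G.graph.V)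
    (Λv : G.graph.V → Subgroup D.Tp)
    (hvert : ∀ v : 𝒢.graph.Vertex, (Λv (σ v)).map (e : D.Tp →* c.G) ∈ verticialSubgroups c v)
    (hΛv : ∀ v, (Λv v).map D.ι = G.vertGp v)
    (src tgt : G.graph.N → G.graph.V) (c₁ c₂ : G.graph.N → D.Tp)
    (hends : ∀ e, G.graph.nodeEnds e = s(src e, tgt e))
    (h₁ : ∀ e, G.nodeGp e ≤ MulAut.conj (D.ι (c₁ e)) • G.vertGp (src e))
    (h₂ : ∀ e, G.nodeGp e ≤ MulAut.conj (D.ι (c₂ e)) • G.vertGp (tgt e))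
    (hloop : ∀ e, src e = tgt e → (c₁ e)⁻¹ * c₂ e ∉ Λv (src e))
    (cH : TemperedPiChart 𝒢H) (eH : (D.restrictH hcH).Tp ≃ₜ* cH.G) (h𝒢H : 𝒢H.Thm37Hypotheses)
    (hPCH : IsProfiniteCompletion
      ({ toMonoidHom := (D.restrictH hcH).ι, continuous_toFun := (D.restrictH hcH).ι_continuous } :
        (D.restrictH hcH).Tp →ₜ* (D.restrictH hcH).Hat))
    (GH : PSCDatum (D.restrictH hcH).Hat) (hNNH : GH.VerticialIntersectionNear)
    (σH : 𝒢H.graph.Vertex ≃ GH.graph.V)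
    (ΛvH : GH.graph.V → Subgroup (D.restrictH hcH).Tp)
    (hvertH : ∀ v : 𝒢H.graph.Vertex,
      (ΛvH (σH v)).map (eH : (D.restrictH hcH).Tp →* cH.G) ∈ verticialSubgroups cH v)
    (hΛvH : ∀ v, (ΛvH v).map (D.restrictH hcH).ι = GH.vertGp v)
    (srcH tgtH : GH.graph.N → GH.graph.V) (c₁H c₂H : GH.graph.N → (D.restrictH hcH).Tp)
    (hendsH : ∀ e, GH.graph.nodeEnds e = s(srcH e, tgtH e))
    (h₁H : ∀ e, GH.nodeGp e ≤ MulAut.conj ((D.restrictH hcH).ι (c₁H e)) • GH.vertGp (srcH e))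
    (h₂H : ∀ e, GH.nodeGp e ≤ MulAut.conj ((D.restrictH hcH).ι (c₂H e)) • GH.vertGp (tgtH e))
    (hloopH : ∀ e, srcH e = tgtH e → (c₁H e)⁻¹ * c₂H e ∉ ΛvH (srcH e))
    (hHatH : IsCommensurablyTerminal D.HatH) :
    D.CommensuratorsOfDecompositionSubgroups :=
  D.prop22_byName_at hcH c e h𝒢 compactInVerticialAt_of_finiteGraph verticialInjective_holds hPC
    (galoisDomination_of_prop36 h𝒢.toProp36Hypotheses) G hNN σ Λv hvert hΛv src tgt c₁ c₂ hends h₁ h₂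
    hloop cH eH h𝒢H compactInVerticialAt_of_finiteGraph hPCH
    (galoisDomination_of_prop36 h𝒢H.toProp36Hypotheses) GH hNNH σH ΛvH hvertH hΛvH srcH tgtH c₁H c₂H
    hendsH h₁H h₂H hloopH hHatH

end TemperedGraphGroupData

end Literature.IUT.HodgeTheaters
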